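/- Width seat `ym-line-cbag-p1-w3` (prover-ym-line-cbag-p1-w3-g0-0), route `ColdBoxAllGroups`, crux `BoxFloorAllGroups`
(stmt-QuantumFields-22254), line `birth`, lead's PLAN v5: glue «ChartWindowG» — discharging the chart-window hypotheses of brick B4
«RepresentationG» eventually in `β`. -/
import Summits.QuantumFields.YangMills.Theorems.ColdBoxAllGroupsBoxFloorAllGroupsRepresentationG
import Summits.QuantumFields.YangMills.Theorems.WeakCouplingRatesColdBoxExponents

/-!
# Crux `BoxFloorAllGroups`, glue «ChartWindowG»: the link window of the one-scale expansion lies in a chart ball, eventually in `β`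

Brick B4 «RepresentationG» (`integral_cond_boxState_eq_integral_tilted_G`) takes as hypotheses (a) `hball`: every group element within the
link window `‖ρ u − 1‖_F ≤ η_β`, `η_β = (12H²+2H+1)·√2·√(β^{2ε−1})`, `H = ⌈β^θ⌉`, is a chart point `expChart ρ a` with `‖a‖ ≤ r`; (b) the
charged Gaussian event `gaussD(S) ≠ 0`.  This file discharges them for the assembly (brick B9):
* `linkWindow_subset_image_expChart` — von Neumann's local surjectivity (`exists_chartRadius`) in window form: there is `η₀ = η₀(ρ) > 0`
  with: for `0 ≤ η ≤ η₀`, every `u` with `‖ρ u − 1‖ ≤ η` lies in `expChart ρ '' closedBall 0 (2η)`;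
* `eta_le` — `η_β ≤ 53·√2·β^{2θ+ε−1/2}` for `β ≥ 1`; `tendsto_eta_bound` / **`eventually_linkWindow_subset_image_expChart`** — for `0 < θ`
  and `2θ + ε < 1/2` (the exponent window of the `SU(2)` proof, `ε = 3θ`, `θ ≤ 1/100`): for every `κ > 0`, eventually in `β`, `η_β ≤ κ` and
  the link window lies in `expChart ρ '' closedBall 0 (2η_β)` (so B4 applies with any `r ≥ 2η_β`, e.g. `r = κ'` fixed or `r = 2η_β → 0`);
* `measure_ne_zero_of_real_compl_lt_one` — a probability measure charges an event whose complement has mass `< 1` (for `hγ` from the lead's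
  `gaussD_real_compl_goodTE_inter_ball_le`, and for `hG0` from B2).
No sorry; no definition; standard axioms.  NOT a claim about the Yang–Mills mass gap (rung-level support, RECORD label).
-/

set_option autoImplicit false

noncomputable section

open MeasureTheory Filter Topology Metric
open scoped Matrix.Norms.Frobenius
open Literature.MathematicalPhysics.QuantumLattice
open Literature.MathematicalPhysics.QuantumFieldTheory

namespace Summit.QuantumFields.YangMills.Theorems.ColdBoxAllGroups

open Summit.QuantumFields.YangMills.Theorems.WeakCouplingRates
open Summit.QuantumFields.YangMills.Theorems.FreeEnergyLogCoefficient

/-! ## Local surjectivity in window form -/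

section Window

variable {N : ℕ} {G : Type*} [Group G] [TopologicalSpace G] [CompactSpace G] (ρ : G →* Matrix (Fin N) (Fin N) ℂ)

/-- **The link window lies in a chart ball** (von Neumann local surjectivity, window form): for a faithful continuous unitary `ρ` there
is `η₀ > 0` such that for `0 ≤ η ≤ η₀` every `u` with `‖ρ u − 1‖_F ≤ η` is `expChart ρ a` for some `‖a‖ ≤ 2η`. -/
theorem linkWindow_subset_image_expChart (hρc : Continuous ρ) (hinj : Function.Injective ρ)
    (hρu : ∀ g, ρ g ∈ Matrix.unitaryGroup (Fin N) ℂ) :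
    ∃ η₀ : ℝ, 0 < η₀ ∧ ∀ η : ℝ, η ≤ η₀ → ∀ u : G, ‖ρ u - 1‖ ≤ η →
      u ∈ expChart ρ '' closedBall (0 : EuclideanSpace ℝ (Fin (dimE ρ))) (2 * η) := by
  obtain ⟨r₁, hr₁, -, hsurj⟩ := exists_chartRadius ρ hρc hinj hρu
  refine ⟨2 * r₁, by positivity, fun η hη u hu => ?_⟩
  obtain ⟨a, hau, han⟩ := hsurj u (hu.trans hη)
  exact ⟨a, mem_closedBall_zero_iff.2 (han.trans (by linarith)), hau⟩

end Window

/-! ## The link scale `η_β = (12⌈β^θ⌉² + 2⌈β^θ⌉ + 1)·√2·√(β^{2ε−1})` tends to `0` when `2θ + ε < 1/2` -/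

/-- `η_β ≤ 53·√2·β^{2θ + ε − 1/2}` for `β ≥ 1`, `θ ≥ 0` (`⌈β^θ⌉ ≤ 2β^θ`, `√(β^{2ε−1}) = β^{ε−1/2}`). -/
theorem eta_le {β θ ε : ℝ} (hβ : 1 ≤ β) (hθ : 0 ≤ θ) :
    (12 * (⌈β ^ θ⌉₊ : ℝ) ^ 2 + 2 * ⌈β ^ θ⌉₊ + 1) * (Real.sqrt 2 * Real.sqrt (β ^ (2 * ε - 1))) ≤
      53 * Real.sqrt 2 * β ^ (2 * θ + ε - 1 / 2) := by
  have hβ0 : 0 < β := by linarith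
  obtain ⟨hH1, hH2⟩ := one_le_ceil_rpow_and_le (A := θ) hβ hθ
  have hy : 1 ≤ β ^ θ := Real.one_le_rpow hβ hθ
  have hpoly : 12 * (⌈β ^ θ⌉₊ : ℝ) ^ 2 + 2 * ⌈β ^ θ⌉₊ + 1 ≤ 53 * (β ^ θ) ^ 2 := by nlinarith
  have hsq : Real.sqrt (β ^ (2 * ε - 1)) = β ^ (ε - 1 / 2) := by
    rw [Real.sqrt_eq_rpow, ← Real.rpow_mul hβ0.le]; congr 1; ring
  have hexp : (β ^ θ) ^ 2 * β ^ (ε - 1 / 2) = β ^ (2 * θ + ε - 1 / 2) := by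
    rw [← Real.rpow_natCast, ← Real.rpow_mul hβ0.le, ← Real.rpow_add hβ0]; congr 1; push_cast; ring
  rw [hsq]
  have h0 : 0 ≤ Real.sqrt 2 * β ^ (ε - 1 / 2) := by positivity
  calc (12 * (⌈β ^ θ⌉₊ : ℝ) ^ 2 + 2 * ⌈β ^ θ⌉₊ + 1) * (Real.sqrt 2 * β ^ (ε - 1 / 2))
      ≤ 53 * (β ^ θ) ^ 2 * (Real.sqrt 2 * β ^ (ε - 1 / 2)) := mul_le_mul_of_nonneg_right hpoly h0
    _ = 53 * Real.sqrt 2 * ((β ^ θ) ^ 2 * β ^ (ε - 1 / 2)) := by ring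
    _ = 53 * Real.sqrt 2 * β ^ (2 * θ + ε - 1 / 2) := by rw [hexp]

/-- The majorant `53·√2·β^{2θ+ε−1/2} → 0` when `2θ + ε < 1/2`. -/
theorem tendsto_eta_bound {θ ε : ℝ} (hwin : 2 * θ + ε < 1 / 2) :
    Tendsto (fun β : ℝ => 53 * Real.sqrt 2 * β ^ (2 * θ + ε - 1 / 2)) atTop (𝓝 0) := by
  have hs : 0 < 1 / 2 - 2 * θ - ε := by linarith
  have h := tendsto_const_mul_rpow_of_neg (53 * Real.sqrt 2) hs
  refine h.congr' (Eventually.of_forall fun β => ?_)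
  simp only [neg_sub]
  congr 1; congr 1; ring

/-- **Eventually the link scale is below any `κ > 0`**: for `0 ≤ θ`, `2θ + ε < 1/2`, eventually in `β`, `η_β ≤ κ`. -/
theorem eventually_eta_le {θ ε κ : ℝ} (hθ : 0 ≤ θ) (hwin : 2 * θ + ε < 1 / 2) (hκ : 0 < κ) :
    ∀ᶠ β : ℝ in atTop, (12 * (⌈β ^ θ⌉₊ : ℝ) ^ 2 + 2 * ⌈β ^ θ⌉₊ + 1) * (Real.sqrt 2 * Real.sqrt (β ^ (2 * ε - 1))) ≤ κ := by
  filter_upwards [(tendsto_eta_bound hwin).eventually (Iic_mem_nhds hκ), eventually_ge_atTop (1 : ℝ)] with β hβ hβ1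
  exact (eta_le (ε := ε) hβ1 hθ).trans hβ

/-- **The link window lies in the chart ball, eventually in `β`.**  For a faithful continuous unitary `ρ`, `0 ≤ θ`, `2θ + ε < 1/2` and any
`κ > 0`: eventually in `β`, `η_β ≤ κ` and every `u` with `‖ρ u − 1‖_F ≤ η_β` (`η_β` the link scale at `H = ⌈β^θ⌉`) lies in
`expChart ρ '' closedBall 0 (2η_β)` — the hypothesis `hball` of brick B4 with `r = 2η_β` (and, by monotonicity of balls, with any `r ≥ 2η_β`). -/
theorem eventually_linkWindow_subset_image_expChart {N : ℕ} {G : Type*} [Group G] [TopologicalSpace G] [CompactSpace G]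
    (ρ : G →* Matrix (Fin N) (Fin N) ℂ) (hρc : Continuous ρ) (hinj : Function.Injective ρ)
    (hρu : ∀ g, ρ g ∈ Matrix.unitaryGroup (Fin N) ℂ) {θ ε κ : ℝ} (hθ : 0 ≤ θ) (hwin : 2 * θ + ε < 1 / 2) (hκ : 0 < κ) :
    ∀ᶠ β : ℝ in atTop,
      (12 * (⌈β ^ θ⌉₊ : ℝ) ^ 2 + 2 * ⌈β ^ θ⌉₊ + 1) * (Real.sqrt 2 * Real.sqrt (β ^ (2 * ε - 1))) ≤ κ ∧
      ∀ u : G, ‖ρ u - 1‖ ≤ (12 * (⌈β ^ θ⌉₊ : ℝ) ^ 2 + 2 * ⌈β ^ θ⌉₊ + 1) * (Real.sqrt 2 * Real.sqrt (β ^ (2 * ε - 1))) →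
        u ∈ expChart ρ '' closedBall (0 : EuclideanSpace ℝ (Fin (dimE ρ)))
          (2 * ((12 * (⌈β ^ θ⌉₊ : ℝ) ^ 2 + 2 * ⌈β ^ θ⌉₊ + 1) * (Real.sqrt 2 * Real.sqrt (β ^ (2 * ε - 1))))) := by
  obtain ⟨η₀, hη₀, hwinη⟩ := linkWindow_subset_image_expChart ρ hρc hinj hρu
  filter_upwards [eventually_eta_le (ε := ε) hθ hwin (lt_min hκ hη₀)] with β hβ
  exact ⟨hβ.trans (min_le_left _ _), hwinη _ (hβ.trans (min_le_right _ _))⟩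

/-! ## Charged events -/

/-- A probability measure charges an event whose complement has mass `< 1`. -/
theorem measure_ne_zero_of_real_compl_lt_one {Ω : Type*} [MeasurableSpace Ω] (μ : Measure Ω) [IsProbabilityMeasure μ] {S : Set Ω}
    (hS : MeasurableSet S) (h : μ.real Sᶜ < 1) : μ S ≠ 0 := by
  intro h0
  have h1 : μ.real S = 0 := by rw [measureReal_def, h0, ENNReal.toReal_zero]
  have h2 : μ.real S + μ.real Sᶜ = 1 := by rw [measureReal_add_measureReal_compl hS, probReal_univ]
  linarith

end Summit.QuantumFields.YangMills.Theorems.ColdBoxAllGroups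

end
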